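import Literature.Probability.Percolation.FoldingFibres
import Literature.Probability.LatticeModels.RandomClusterEdgeWeights
import HarnessLib

/-!
# Graded folding for the random-cluster measure with edge parameters

Support file for `stmt-CriticalPhenomena-4575` (memo `prim-gen-kcluster/KCLUSTER-gen52.md` §1, LEMMA F —
the analytic half; `KCLUSTER-gen78.md`).  No definitions, no named facts, no sorries.

The folding identity of `Literature.Probability.Percolation.FoldingFibres` (van den Berg–Fiebig /
Reimer / Linusson: group the pairs `(a, b)` of configurations by the disagreement set `M = a ∆ b` and the
common value `u = a \ M` off `M`; on a fibre the product weight `w(a) w(a ∆ M)` is constant) is extended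
from the product measure to the random-cluster measure `φ = rcMeasureW w q B` (weights
`w(ω) q^{k^B(ω)}`): the `p`-part is still constant on each fibre, the `q`-part is `q^{g}` with the
GRADE `g(a) = k^B(a) + k^B(a ∆ M)` of the pair.  Hence:

* `sum_rcWeightW_ind_mul_sum_eq_sum_fibres` — `(Z φ(A)) (Z φ(B)) = ∑_M ∑_u w(u) w(u ∆ M) ·
  ∑_{a : a \ M = u, a ∈ A, a ∆ M ∈ B} q^{g(a)}`;
* `rcMeasureW_real_mul_le_of_graded_fibrewise` — **graded fibrewise domination implies the product
  inequality for every `q > 0` and every edge-parameter vector**: if on every fibre `(M, u)` inside the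
  support and at every level `t` the number of `a` with `a ∈ A₁`, `a ∆ M ∈ B₁`, `g(a) = t` is at most the
  number with `a ∈ A₂`, `a ∆ M ∈ B₂`, `g(a) = t`, then `φ(A₁) φ(B₁) ≤ φ(A₂) φ(B₂)`.

With the dictionary "fibre = free edges `M` plus doubled edges `u`; `a` = open set of the first copy;
`g` = number of open plus number of closed clusters" this is the analytic half of gen-52 LEMMA F
(graded ANTI₁ ⟹ the refined row R1 for random-cluster measures, all `q > 0`); the combinatorial half is
`AntipodalR1.card_fibreForm_grade_le_of_graded` (`…AntipodalR1GradedFibreForm`).  [this work]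
-/

noncomputable section

namespace Summit.CriticalPhenomena.PercolationContinuityZ3.Theorems

namespace AntipodalR1

open MeasureTheory Set Finset
open scoped symmDiff Classical
open Literature.Probability.Percolation (BondConfig)
open Literature.Probability.Percolation.BHK2006 (weight weight_nonneg)
open Literature.Probability.Percolation.DecisionTree (ind ind_of_mem ind_of_not_mem)
open Literature.Probability.Percolation (weight_mul_weight_symmDiff_eq)
open Literature.Probability.LatticeModels (rcWeightW rcPartitionFunctionW rcMeasureW clusterCount
  rcMeasureW_real_eq_sum_div rcPartitionFunctionW_pos)

variable {V : Type*} [Fintype V]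

/-- **Graded folding identity** for weights `w(a) · φ(a)` with an arbitrary extra factor `φ`:
`(∑_a w(a)φ(a)1_A(a)) (∑_b w(b)φ(b)1_B(b)) = ∑_M ∑_u w(u) w(u ∆ M) · ∑_{a \ M = u, a ∈ A, a ∆ M ∈ B} φ(a)φ(a ∆ M)`.
[this work] -/
theorem sum_weight_mul_ind_mul_sum_eq_sum_fibres {ι : Type*} [Fintype ι] (w : ι → ℝ)
    (φ : Set ι → ℝ) (A B : Set (Set ι)) :
    (∑ a : Set ι, weight w a * φ a * ind A a) * (∑ b : Set ι, weight w b * φ b * ind B b) =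
      ∑ M : Set ι, ∑ u : Set ι, weight w u * weight w (u ∆ M) *
        ∑ a ∈ (Finset.univ.filter fun a : Set ι => a \ M = u ∧ a ∈ A ∧ a ∆ M ∈ B), φ a * φ (a ∆ M) := by
  rw [Finset.sum_mul_sum]
  have step1 : ∀ a : Set ι, ∑ b : Set ι, weight w a * φ a * ind A a * (weight w b * φ b * ind B b) =
      ∑ M : Set ι, weight w a * φ a * ind A a * (weight w (a ∆ M) * φ (a ∆ M) * ind B (a ∆ M)) := by
    intro a
    let e : Equiv.Perm (Set ι) :=
      Function.Involutive.toPerm (fun M : Set ι => a ∆ M) (symmDiff_right_involutive a)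
    calc ∑ b : Set ι, weight w a * φ a * ind A a * (weight w b * φ b * ind B b)
        = ∑ M : Set ι, weight w a * φ a * ind A a * (weight w (e M) * φ (e M) * ind B (e M)) :=
          (Equiv.sum_comp e (fun b => weight w a * φ a * ind A a * (weight w b * φ b * ind B b))).symm
      _ = _ := Finset.sum_congr rfl fun M _ => rfl
  simp_rw [step1]
  rw [Finset.sum_comm]
  refine Finset.sum_congr rfl fun M _ => ?_
  rw [← Finset.sum_fiberwise Finset.univ (fun a : Set ι => a \ M)
    (fun a => weight w a * φ a * ind A a * (weight w (a ∆ M) * φ (a ∆ M) * ind B (a ∆ M)))]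
  refine Finset.sum_congr rfl fun u _ => ?_
  have hfib : ∀ a ∈ (Finset.univ.filter fun a : Set ι => a \ M = u),
      weight w a * φ a * ind A a * (weight w (a ∆ M) * φ (a ∆ M) * ind B (a ∆ M)) =
        weight w u * weight w (u ∆ M) *
          (if a ∈ A ∧ a ∆ M ∈ B then φ a * φ (a ∆ M) else 0) := by
    intro a ha
    have hau : a \ M = u := (Finset.mem_filter.1 ha).2
    rw [show weight w a * φ a * ind A a * (weight w (a ∆ M) * φ (a ∆ M) * ind B (a ∆ M)) =
        (weight w a * weight w (a ∆ M)) * ((ind A a * ind B (a ∆ M)) * (φ a * φ (a ∆ M))) by ring,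
      weight_mul_weight_symmDiff_eq w hau]
    congr 1
    by_cases h1 : a ∈ A <;> by_cases h2 : a ∆ M ∈ B <;>
      simp [ind_of_mem, ind_of_not_mem, h1, h2]
  rw [Finset.sum_congr rfl hfib, ← Finset.mul_sum, Finset.sum_ite, Finset.sum_const_zero, add_zero,
    Finset.filter_filter]

/-- A fibre meeting an edge of weight zero has weight zero. [this work] -/
theorem weight_mul_weight_symmDiff_eq_zero {ι : Type*} [Fintype ι] (w : ι → ℝ) {M u : Set ι}
    {e : ι} (he : e ∈ M ∪ u) (hwe : w e = 0) : weight w u * weight w (u ∆ M) = 0 := by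
  rcases he with heM | heu
  · by_cases heu : e ∈ u
    · have : weight w u = 0 :=
        Finset.prod_eq_zero (Finset.mem_univ e) (by rw [if_pos heu, hwe])
      rw [this, zero_mul]
    · have hmem : e ∈ u ∆ M := Set.mem_symmDiff.2 (Or.inr ⟨heM, heu⟩)
      have : weight w (u ∆ M) = 0 :=
        Finset.prod_eq_zero (Finset.mem_univ e) (by rw [if_pos hmem, hwe])
      rw [this, mul_zero]
  · have : weight w u = 0 :=
      Finset.prod_eq_zero (Finset.mem_univ e) (by rw [if_pos heu, hwe])
    rw [this, zero_mul]

/-- Level decomposition of a graded sum: if the level sets of `F₁` are no larger than those of `F₂`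
for a grading `g`, then `∑_{F₁} q^{g} ≤ ∑_{F₂} q^{g}` for `q ≥ 0`. [this work] -/
theorem sum_pow_le_of_graded {α : Type*} (F₁ F₂ : Finset α) (g : α → ℕ) {q : ℝ} (hq : 0 ≤ q)
    (h : ∀ t : ℕ, (F₁.filter fun a => g a = t).card ≤ (F₂.filter fun a => g a = t).card) :
    ∑ a ∈ F₁, q ^ g a ≤ ∑ a ∈ F₂, q ^ g a := by
  set T := (F₁ ∪ F₂).image g with hT
  have h1 : ∀ a ∈ F₁, g a ∈ T := fun a ha => Finset.mem_image_of_mem g (Finset.mem_union_left _ ha)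
  have h2 : ∀ a ∈ F₂, g a ∈ T := fun a ha => Finset.mem_image_of_mem g (Finset.mem_union_right _ ha)
  rw [← Finset.sum_fiberwise_of_maps_to h1, ← Finset.sum_fiberwise_of_maps_to h2]
  refine Finset.sum_le_sum fun t _ => ?_
  have e : ∀ F : Finset α, ∑ a ∈ F.filter (fun a => g a = t), q ^ g a =
      ((F.filter fun a => g a = t).card : ℝ) * q ^ t := by
    intro F
    rw [Finset.sum_congr rfl (fun a ha => by rw [(Finset.mem_filter.1 ha).2] :
      ∀ a ∈ F.filter (fun a => g a = t), q ^ g a = q ^ t), Finset.sum_const, nsmul_eq_mul]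
  rw [e, e]
  exact mul_le_mul_of_nonneg_right (by exact_mod_cast h t) (pow_nonneg hq t)

/-- **Graded folding for the random-cluster measure** (`φ = rcMeasureW w q B`, any wired set `B`,
any `q > 0`): `(Z φ(A)) · (Z φ(B)) = ∑_M ∑_u w(u) w(u ∆ M) · ∑_{a \ M = u, a ∈ A, a ∆ M ∈ B} q^{k^B(a) + k^B(a ∆ M)}`.
[this work] -/
theorem sum_rcWeightW_ind_mul_sum_eq_sum_fibres (w : Sym2 V → unitInterval) (q : ℝ) (B : Set V)
    (A A' : Set (BondConfig V)) :
    (∑ a : Set (Sym2 V), rcWeightW w q B a * ind A a) * (∑ b : Set (Sym2 V), rcWeightW w q B b * ind A' b) =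
      ∑ M : Set (Sym2 V), ∑ u : Set (Sym2 V),
        weight (fun e => (w e : ℝ)) u * weight (fun e => (w e : ℝ)) (u ∆ M) *
          ∑ a ∈ (Finset.univ.filter fun a : Set (Sym2 V) => a \ M = u ∧ a ∈ A ∧ a ∆ M ∈ A'),
            q ^ (clusterCount a B + clusterCount (a ∆ M) B) := by
  have hW : ∀ (C : Set (BondConfig V)) (a : Set (Sym2 V)), rcWeightW w q B a * ind C a =
      weight (fun e => (w e : ℝ)) a * q ^ clusterCount a B * ind C a := fun C a => rfl
  simp_rw [hW, sum_weight_mul_ind_mul_sum_eq_sum_fibres, pow_add]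

/-- **Graded fibrewise domination implies the product inequality, for every `q > 0` and every
edge-parameter vector** (analytic half of gen-52 LEMMA F).  Let `w` vanish off `D₀`.  If for every fibre
`(M, u)` with `u ∩ M = ∅`, `M ∪ u ⊆ D₀`, and every level `t`, the number of `a` with `a \ M = u`,
`a ∈ A₁`, `a ∆ M ∈ B₁` and `k^B(a) + k^B(a ∆ M) = t` is at most the number with `A₂, B₂` in place of
`A₁, B₁`, then `φ(A₁) φ(B₁) ≤ φ(A₂) φ(B₂)` for `φ = rcMeasureW w q B`. [this work] -/
theorem rcMeasureW_real_mul_le_of_graded_fibrewise (w : Sym2 V → unitInterval) {q : ℝ} (hq : 0 < q)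
    (B : Set V) (D₀ : Set (Sym2 V)) (hD : ∀ e, e ∉ D₀ → (w e : ℝ) = 0)
    (A₁ B₁ A₂ B₂ : Set (BondConfig V))
    (h : ∀ M u : Set (Sym2 V), Disjoint u M → M ∪ u ⊆ D₀ → ∀ t : ℕ,
      ((Finset.univ.filter fun a : Set (Sym2 V) => a \ M = u ∧ a ∈ A₁ ∧ a ∆ M ∈ B₁).filter
          fun a => clusterCount a B + clusterCount (a ∆ M) B = t).card ≤
        ((Finset.univ.filter fun a : Set (Sym2 V) => a \ M = u ∧ a ∈ A₂ ∧ a ∆ M ∈ B₂).filter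
          fun a => clusterCount a B + clusterCount (a ∆ M) B = t).card) :
    (rcMeasureW w q B).real A₁ * (rcMeasureW w q B).real B₁ ≤
      (rcMeasureW w q B).real A₂ * (rcMeasureW w q B).real B₂ := by
  have hZ := rcPartitionFunctionW_pos w hq B
  rw [rcMeasureW_real_eq_sum_div w hq B A₁, rcMeasureW_real_eq_sum_div w hq B B₁,
    rcMeasureW_real_eq_sum_div w hq B A₂, rcMeasureW_real_eq_sum_div w hq B B₂,
    div_mul_div_comm, div_mul_div_comm]
  refine div_le_div_of_nonneg_right ?_ (mul_pos hZ hZ).le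
  rw [sum_rcWeightW_ind_mul_sum_eq_sum_fibres, sum_rcWeightW_ind_mul_sum_eq_sum_fibres]
  refine Finset.sum_le_sum fun M _ => Finset.sum_le_sum fun u _ => ?_
  have hw0 : ∀ e, 0 ≤ (fun e => (w e : ℝ)) e := fun e => (w e).2.1
  have hw1 : ∀ e, (fun e => (w e : ℝ)) e ≤ 1 := fun e => (w e).2.2
  have hnn : 0 ≤ weight (fun e => (w e : ℝ)) u * weight (fun e => (w e : ℝ)) (u ∆ M) :=
    mul_nonneg (weight_nonneg hw0 hw1 _) (weight_nonneg hw0 hw1 _)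
  by_cases hd : Disjoint u M
  · by_cases hsupp : M ∪ u ⊆ D₀
    · exact mul_le_mul_of_nonneg_left
        (sum_pow_le_of_graded _ _ _ hq.le (h M u hd hsupp)) hnn
    · -- a fibre leaving the support has weight zero
      obtain ⟨e, he, heD⟩ := Set.not_subset.1 hsupp
      rw [weight_mul_weight_symmDiff_eq_zero (fun e => (w e : ℝ)) he (hD e heD), zero_mul, zero_mul]
  · -- off the locus `u ∩ M = ∅` both fibres are empty
    have hempty : ∀ C D : Set (BondConfig V),
        (Finset.univ.filter fun a : Set (Sym2 V) => a \ M = u ∧ a ∈ C ∧ a ∆ M ∈ D) = ∅ := by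
      intro C D
      refine Finset.filter_eq_empty_iff.2 fun a _ ha => hd ?_
      rw [← ha.1]
      exact disjoint_sdiff_self_left
    rw [hempty, hempty]

end AntipodalR1

end Summit.CriticalPhenomena.PercolationContinuityZ3.Theorems
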